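import Summits.QuantumFields.BalabanUV.Beta.FP.RootFixingGaugeForm

/-!
# `BalabanUV.Beta.FP.ValueFunctionThirdJet` — road «FP» for binder row D1, row **H2V-4′-a (MODEL)** of `LEAVES-FP.md` ∕ owner memo
# `H2V4-STATEMENT.md` §2–§3 (owner d1-p3-g6, journal 2026-08-21T00:49Z): **THE CRITICAL BRANCH OF A CONSTRAINED VARIATIONAL PROBLEM WITH A
# NONLINEAR CONSTRAINT, TO THIRD ORDER ALONG A LINE** — `Q′H = 1`, `Q′U″ = −Q″[H,H]`, the stationarity differentiated once and twice, and the raw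
# third-order identity `(ω″[a,a]) ⬝ a = −A‴[Ha,Ha,Ha] − 3·ω̇[a] ⬝ ∂²Q[Ha,Ha]` at a tadpole-free base point (the value function is the sequel
# `FP/ValueFunctionThirdJetEnvelope`)

HONEST DEPENDENCY (cell records, verbatim): «continuum YM on T⁴ ⇐ BetaPertH ∧ nine spine estimates (0/9 proved); BetaPertH ⇐ (D1) ∧ (D4) ∧
CAP+tail; G-an2-4 gates asym, D1 and NE2/3/4.»  HONEST FRAMING (cell contract, verbatim): «discharging `BetaPertH` makes Bałaban's UV stability
UNCONDITIONAL — a real constructive-QFT result; it is NOT the continuum limit and NOT the Clay problem.»  THIS MODULE is [folklore] finite-dimensional calculus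
(Mathlib `HasFDerivAt.comp_hasDerivAt`, `hasDerivAt_pi`, `HasDerivAt.fun_sum ∕ mul`, uniqueness of derivatives) in the idiom of an2's K-U5
`Beta/ConstrainedCriticalMap` §4 (`fderiv_eq_of_identities`: ANY differentiable pair satisfying the two identities of a constrained critical branch —
NO inverse-function theorem, NO existence statement) extended from a constraint MATRIX `C` to a NONLINEAR constraint map `Q` with Jacobian field
`Jf` and from first to THIRD order, over `CompositionSingular` (`minOp`, `effForm`, `blocks_mul_kkt`) and `FP/OneShotKKTTorus` ∕ `FP/RootFixingGaugeForm`
(`hasDerivAt_jet₁_comp_curve`, `hasDerivAt_ax_line`, `hasDerivAt_dax_line`) BY NAME.  NO estimate, NO lattice object, nothing of Bałaban's manuscripts,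
no definition, no `def … : Prop`, nothing cited, 0 sorry.  It discharges NOTHING of `hgerm`∕`hbook`∕`hasym`∕D1.  NOT D1, NOT BetaPertH, NOT continuum,
NOT Clay.

ABSOLUTE RULE (cell charter, verbatim): «No internally-minted statement may enter as a cited fact. Every hypothesis is either kernel-proved in this
package or a verbatim quotation of a PUBLISHED theorem with page reference. The manuscript(s) under audit are NOT citable for their own disputed
steps — they are the thing under adjudication; programme-internal (2001/route/tribunal) claims are never citable.»

THE ROW (owner, `H2V4-STATEMENT.md` §2 ∕ §3, verbatim core): «By the implicit-function∕envelope calculus at the constrained minimiser `u = H_j(U)` …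
`∂³S_j(𝟙)[a,b,c] = ∂³S_W(𝟙)[H_ja, H_jb, H_jc] − 3·Sym⟨Δ_j a, ∂²Q_j(𝟙)[H_jb, H_jc]⟩` (the second term = the multiplier correction: `η′ = Δ_j a` is the
value-function gradient's derivative) … H2V-4′-a (MODEL∕road identity, M): … over the tree's value-function∕minimiser calculus; first refusal an2∕an4
lineages, then any seat.»  (an2-g25: «no MINE … GO from the an2 side», journal 2026-08-21T01:52Z.)
LETTERS (all [folklore]; coordinates: fine `κ → ℝ`, coarse `μ → ℝ`; matrix-valued fields are valued in the Pi types and read by `Matrix.of`, as in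
`OneShotKKTTorus`): the action's GRADIENT FIELD `f` with Jacobian (= Hessian) field `Hf` near the branch point and `Hf`'s derivative `dH` at it
(`A‴[v,w,z] = ((Matrix.of (dH v)) *ᵥ w) ⬝ᵥ z`); the CONSTRAINT `Q` with Jacobian field `Jf`, its derivative field `dJf` (`∂²Q[v,w] = (Matrix.of (dJf x v))
*ᵥ w`) and `dJf`'s derivative `d2Jf` at the point; ANY pair (`U` = critical configuration, `ω` = multiplier) with first jets `dU`, `dω` near `c₀` and
second jets `d2U`, `d2ω` at `c₀` satisfying near `c₀` the two identities **`f (U c) + J(U c)ᵀ ω c = 0`** (stationarity) and **`Q (U c) = c`**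
(constraint); the TADPOLE-FREE base point **`ω c₀ = 0`** is DISPLAYED where used (on the road: `U = 𝟙` is a critical point of `S_W`, so the multiplier
vanishes there — not proved here).
WHAT IS PROVED: §0 product rules `hasDerivAt_of_mulVec`, `hasDerivAt_of_transpose_mulVec`, `hasDerivAt_dotProduct`, `transpose_mulVec_dotProduct`;
§1 along the line `c₀ + s•a`: **`jac_mulVec_dU_line`** (`J(U)·dU a = a` near 0 — «`Q′H = 1`»), **`jac_mulVec_d2U`** (`∂²Q[dU a, dU a] + J·d2U a a = 0` —
«`Q′U″ = −Q″[H,H]`»), **`stationarity_deriv_line`** (`H(U)·dU a + (∂J[dU a])ᵀ ω + J(U)ᵀ dω a = 0` near 0), **`dU_dω_eq_of_identities`** (tadpole-free +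
`kkt H_c J_c` nonsingular ⟹ `dU c₀ a = minOp H_c J_c a`, `dω c₀ a = −effForm H_c J_c a` — the nonlinear twin of K-U5 §4); §2 **`d2ω_dotProduct`**: with
`w := dU c₀ a`, `w₁ := dω c₀ a`, `Hf (U c₀)` symmetric and `ω c₀ = 0` (NO non-degeneracy needed),
`(d2ω a a) ⬝ a = −A‴[w,w,w] − 3·(w₁ ⬝ ∂²Q[w,w])` — the stationarity differentiated twice, paired with `w`, the `U″`-term traded for `−Q″[w,w]` by the
symmetry of the Hessian.
NOT HERE (honest): existence∕uniqueness of the branch for a nonlinear `Q` (IFT), the road instance (`A = S_W`, `Q = Q_j` — no tree object for the nonlinear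
composite average yet: rows H2V-4′-b∕c∕d), the polarised `[a,b,c]` form, any estimate; 0∕4 row-D1 binders touched.
Provenance: NE9 formalisation swarm leaf seat `b2b-balaban-t4-ne9-formalise-leaf-04` gen 38 on cross-cell kernel duty (road «FP» row H2V-4′-a; OFFER
journal 2026-08-21T01:5xZ subordinate to the an2∕an4 first refusal), 2026-08-21.
-/

noncomputable section

namespace Summit.QuantumFields.BalabanUV.Beta.FP.ValueFunctionThirdJet

open Matrix Filter Topology
open Literature.MathematicalPhysics.QuantumFieldTheory.Balaban1983to89.Beta.Composition (kkt)
open Literature.MathematicalPhysics.QuantumFieldTheory.Balaban1983to89.Beta.CompositionSingular (flucCov minOp minOpL effForm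
  kkt_mul_blocks blocks_mul_kkt)
open Summit.QuantumFields.BalabanUV.Beta.ConstrainedCriticalMap (mulVecCLM mulVecCLM_apply dotCLM dotCLM_apply)
open Summit.QuantumFields.BalabanUV.Beta.FP.OneShotKKTTorus (hasDerivAt_comp_curve hasDerivAt_jet₁_comp_curve hasDerivAt_comp_line)
open Summit.QuantumFields.BalabanUV.Beta.FP.RootFixingGaugeForm (hasDerivAt_ax_line hasDerivAt_dax_line)

/-! ## §0 Product rules for `M(s) *ᵥ v(s)`, `M(s)ᵀ *ᵥ v(s)`, `v(s) ⬝ᵥ w(s)` (entrywise; curves valued in the Pi types) -/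

section Curves

variable {ι θ : Type*} [Fintype ι] [Fintype θ]

omit [Fintype ι] in
/-- [folklore] `(M v)′ = M′ v + M v′` for a matrix curve `M` (valued in `ι → θ → ℝ`, read as a matrix by `Matrix.of`) and a vector curve `v`. -/
theorem hasDerivAt_of_mulVec {M : ℝ → ι → θ → ℝ} {v : ℝ → θ → ℝ} {M' : ι → θ → ℝ} {v' : θ → ℝ} {t : ℝ}
    (hM : HasDerivAt M M' t) (hv : HasDerivAt v v' t) :
    HasDerivAt (fun s => Matrix.of (M s) *ᵥ v s) (Matrix.of M' *ᵥ v t + Matrix.of (M t) *ᵥ v') t := by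
  have hMe : ∀ i j, HasDerivAt (fun s => M s i j) (M' i j) t := fun i j => (hasDerivAt_pi.1 ((hasDerivAt_pi.1 hM) i)) j
  have hve : ∀ j, HasDerivAt (fun s => v s j) (v' j) t := fun j => (hasDerivAt_pi.1 hv) j
  refine hasDerivAt_pi.2 fun i => ?_
  have h := HasDerivAt.fun_sum (u := (Finset.univ : Finset θ)) (fun j _ => (hMe i j).mul (hve j))
  simp only [Matrix.mulVec, dotProduct, Matrix.of_apply, Pi.add_apply]
  rw [← Finset.sum_add_distrib]
  exact h

/-- [folklore] `(Mᵀ v)′ = M′ᵀ v + Mᵀ v′`. -/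
theorem hasDerivAt_of_transpose_mulVec {M : ℝ → ι → θ → ℝ} {v : ℝ → ι → ℝ} {M' : ι → θ → ℝ} {v' : ι → ℝ} {t : ℝ}
    (hM : HasDerivAt M M' t) (hv : HasDerivAt v v' t) :
    HasDerivAt (fun s => (Matrix.of (M s))ᵀ *ᵥ v s) ((Matrix.of M')ᵀ *ᵥ v t + (Matrix.of (M t))ᵀ *ᵥ v') t := by
  have hMe : ∀ i j, HasDerivAt (fun s => M s i j) (M' i j) t := fun i j => (hasDerivAt_pi.1 ((hasDerivAt_pi.1 hM) i)) j
  have hve : ∀ i, HasDerivAt (fun s => v s i) (v' i) t := fun i => (hasDerivAt_pi.1 hv) i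
  refine hasDerivAt_pi.2 fun j => ?_
  have h := HasDerivAt.fun_sum (u := (Finset.univ : Finset ι)) (fun i _ => (hMe i j).mul (hve i))
  simp only [Matrix.mulVec, dotProduct, Matrix.transpose_apply, Matrix.of_apply, Pi.add_apply]
  rw [← Finset.sum_add_distrib]
  exact h

/-- [folklore] `(v ⬝ w)′ = v′ ⬝ w + v ⬝ w′`. -/
theorem hasDerivAt_dotProduct {v w : ℝ → θ → ℝ} {v' w' : θ → ℝ} {t : ℝ} (hv : HasDerivAt v v' t) (hw : HasDerivAt w w' t) :
    HasDerivAt (fun s => v s ⬝ᵥ w s) (v' ⬝ᵥ w t + v t ⬝ᵥ w') t := by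
  have hve : ∀ j, HasDerivAt (fun s => v s j) (v' j) t := fun j => (hasDerivAt_pi.1 hv) j
  have hwe : ∀ j, HasDerivAt (fun s => w s j) (w' j) t := fun j => (hasDerivAt_pi.1 hw) j
  have h := HasDerivAt.fun_sum (u := (Finset.univ : Finset θ)) (fun j _ => (hve j).mul (hwe j))
  simp only [dotProduct]
  rw [← Finset.sum_add_distrib]
  exact h

/-- [folklore] `(Aᵀ x) ⬝ y = x ⬝ (A y)`. -/
theorem transpose_mulVec_dotProduct (A : Matrix ι θ ℝ) (x : ι → ℝ) (y : θ → ℝ) :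
    (Aᵀ *ᵥ x) ⬝ᵥ y = x ⬝ᵥ (A *ᵥ y) := by
  rw [Matrix.mulVec_transpose, ← Matrix.dotProduct_mulVec]

end Curves

/-! ## §1 The critical branch with a NONLINEAR constraint: first and second order along a line -/

section Branch

variable {κ μ : Type*} [Fintype κ] [Fintype μ] [DecidableEq κ] [DecidableEq μ]

omit [DecidableEq κ] [DecidableEq μ] in
/-- [folklore] **`Q′H = 1` ALONG THE BRANCH.**  If `Q (U c) = c` for `c` near `c₀`, `Q` has Jacobian field `Jf` near `U c₀` and `U` has derivative
field `dU` near `c₀`, then along the line `c₀ + s•a`, for `s` near `0`: `J(U(c₀+s•a)) · dU(c₀+s•a) a = a`. -/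
theorem jac_mulVec_dU_line {Q : (κ → ℝ) → (μ → ℝ)} {Jf : (κ → ℝ) → μ → κ → ℝ} {U : (μ → ℝ) → (κ → ℝ)}
    {dU : (μ → ℝ) → ((μ → ℝ) →L[ℝ] (κ → ℝ))} {c₀ : μ → ℝ}
    (hQ : ∀ᶠ x in 𝓝 (U c₀), HasFDerivAt Q (mulVecCLM (Matrix.of (Jf x))) x) (hU : ∀ᶠ c in 𝓝 c₀, HasFDerivAt U (dU c) c)
    (hid : ∀ᶠ c in 𝓝 c₀, Q (U c) = c) (a : μ → ℝ) :
    ∀ᶠ s in 𝓝 (0 : ℝ), Matrix.of (Jf (U (c₀ + s • a))) *ᵥ dU (c₀ + s • a) a = a := by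
  have hline : ∀ s : ℝ, HasDerivAt (fun s : ℝ => c₀ + s • a) a s := fun s => by
    have h := ((hasDerivAt_id s).smul_const a).const_add c₀
    rwa [one_smul] at h
  have hcont : Tendsto (fun s : ℝ => c₀ + s • a) (𝓝 0) (𝓝 c₀) := by
    have h := (hline 0).continuousAt.tendsto
    rwa [zero_smul, add_zero] at h
  have hu : ∀ᶠ s in 𝓝 (0 : ℝ), HasDerivAt (fun s : ℝ => U (c₀ + s • a)) (dU (c₀ + s • a) a) s := hasDerivAt_ax_line hU a
  have hUc : ContinuousAt U c₀ := hU.self_of_nhds.continuousAt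
  have hQ' : ∀ᶠ s in 𝓝 (0 : ℝ), HasFDerivAt Q (mulVecCLM (Matrix.of (Jf (U (c₀ + s • a))))) (U (c₀ + s • a)) :=
    hcont.eventually (hUc.eventually hQ)
  have hid' : ∀ᶠ s in 𝓝 (0 : ℝ), ∀ᶠ s' in 𝓝 s, Q (U (c₀ + s' • a)) = c₀ + s' • a :=
    (hcont.eventually hid).eventually_nhds
  filter_upwards [hu, hQ', hid'] with s hu hQs hids
  have h1 : HasDerivAt (fun s : ℝ => Q (U (c₀ + s • a))) (Matrix.of (Jf (U (c₀ + s • a))) *ᵥ dU (c₀ + s • a) a) s := by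
    have h := hQs.comp_hasDerivAt s hu
    rwa [mulVecCLM_apply] at h
  have h2 : HasDerivAt (fun s : ℝ => Q (U (c₀ + s • a))) a s := (hline s).congr_of_eventuallyEq hids
  exact h1.unique h2

omit [DecidableEq κ] [DecidableEq μ] in
/-- [folklore] **`Q′U″ = −Q″[H,H]`** (the constraint differentiated twice at the base point): with the Jacobian field's derivative `dJf (U c₀)`
and the second jet `d2U` of `U` at `c₀`, `J(U c₀) · d2U a a + ∂²Q[dU c₀ a, dU c₀ a] = 0`, where `∂²Q[v,w] := Matrix.of (dJf (U c₀) v) *ᵥ w`. -/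
theorem jac_mulVec_d2U {Q : (κ → ℝ) → (μ → ℝ)} {Jf : (κ → ℝ) → μ → κ → ℝ} {dJf : (κ → ℝ) → ((κ → ℝ) →L[ℝ] (μ → κ → ℝ))}
    {U : (μ → ℝ) → (κ → ℝ)} {dU : (μ → ℝ) → ((μ → ℝ) →L[ℝ] (κ → ℝ))} {d2U : (μ → ℝ) →L[ℝ] (μ → ℝ) →L[ℝ] (κ → ℝ)} {c₀ : μ → ℝ}
    (hQ : ∀ᶠ x in 𝓝 (U c₀), HasFDerivAt Q (mulVecCLM (Matrix.of (Jf x))) x) (hJ : HasFDerivAt Jf (dJf (U c₀)) (U c₀))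
    (hU : ∀ᶠ c in 𝓝 c₀, HasFDerivAt U (dU c) c) (hdU : HasFDerivAt dU d2U c₀)
    (hid : ∀ᶠ c in 𝓝 c₀, Q (U c) = c) (a : μ → ℝ) :
    Matrix.of (dJf (U c₀) (dU c₀ a)) *ᵥ dU c₀ a + Matrix.of (Jf (U c₀)) *ᵥ d2U a a = 0 := by
  have e0 : c₀ + (0 : ℝ) • a = c₀ := by rw [zero_smul, add_zero]
  have hu : ∀ᶠ s in 𝓝 (0 : ℝ), HasDerivAt (fun s : ℝ => U (c₀ + s • a)) (dU (c₀ + s • a) a) s := hasDerivAt_ax_line hU a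
  have hu₁ : HasDerivAt (fun s : ℝ => dU (c₀ + s • a) a) (d2U a a) 0 := hasDerivAt_dax_line hdU a
  -- the Jacobian along the line
  have hJ' : HasFDerivAt Jf (dJf (U c₀)) ((fun s : ℝ => U (c₀ + s • a)) 0) := by
    show HasFDerivAt Jf (dJf (U c₀)) (U (c₀ + (0 : ℝ) • a)); rw [e0]; exact hJ
  have hJc : HasDerivAt (fun s : ℝ => Jf (U (c₀ + s • a))) (dJf (U c₀) (dU (c₀ + (0 : ℝ) • a) a)) 0 :=
    hJ'.comp_hasDerivAt (0 : ℝ) hu.self_of_nhds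
  rw [e0] at hJc
  -- differentiate `J·dU a = a` at 0
  have hE := jac_mulVec_dU_line hQ hU hid a
  have h1 := hasDerivAt_of_mulVec hJc hu₁
  simp only [e0] at h1
  have h2 : HasDerivAt (fun s : ℝ => Matrix.of (Jf (U (c₀ + s • a))) *ᵥ dU (c₀ + s • a) a) (0 : μ → ℝ) 0 :=
    (hasDerivAt_const (0 : ℝ) a).congr_of_eventuallyEq hE
  exact h1.unique h2

omit [DecidableEq κ] [DecidableEq μ] in
/-- [folklore] **THE STATIONARITY DIFFERENTIATED ONCE, ALONG THE BRANCH.**  If `f (U c) + J(U c)ᵀ ω c = 0` for `c` near `c₀`, with `f`'s Jacobian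
(Hessian) field `Hf` and the constraint's Jacobian field `Jf`, its derivative field `dJf`, all near `U c₀`, and `U`, `ω` differentiable near `c₀`, then
for `s` near `0`, along `c₀ + s•a`:
`H(U)·dU a + (∂J[dU a])ᵀ·ω + J(U)ᵀ·dω a = 0`. -/
theorem stationarity_deriv_line {f : (κ → ℝ) → (κ → ℝ)} {Hf : (κ → ℝ) → κ → κ → ℝ} {Jf : (κ → ℝ) → μ → κ → ℝ}
    {dJf : (κ → ℝ) → ((κ → ℝ) →L[ℝ] (μ → κ → ℝ))} {U : (μ → ℝ) → (κ → ℝ)} {dU : (μ → ℝ) → ((μ → ℝ) →L[ℝ] (κ → ℝ))}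
    {ω : (μ → ℝ) → (μ → ℝ)} {dω : (μ → ℝ) → ((μ → ℝ) →L[ℝ] (μ → ℝ))} {c₀ : μ → ℝ}
    (hf : ∀ᶠ x in 𝓝 (U c₀), HasFDerivAt f (mulVecCLM (Matrix.of (Hf x))) x)
    (hJ : ∀ᶠ x in 𝓝 (U c₀), HasFDerivAt Jf (dJf x) x)
    (hU : ∀ᶠ c in 𝓝 c₀, HasFDerivAt U (dU c) c) (hω : ∀ᶠ c in 𝓝 c₀, HasFDerivAt ω (dω c) c)
    (hid : ∀ᶠ c in 𝓝 c₀, f (U c) + (Matrix.of (Jf (U c)))ᵀ *ᵥ ω c = 0) (a : μ → ℝ) :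
    ∀ᶠ s in 𝓝 (0 : ℝ), Matrix.of (Hf (U (c₀ + s • a))) *ᵥ dU (c₀ + s • a) a
      + ((Matrix.of (dJf (U (c₀ + s • a)) (dU (c₀ + s • a) a)))ᵀ *ᵥ ω (c₀ + s • a)
        + (Matrix.of (Jf (U (c₀ + s • a))))ᵀ *ᵥ dω (c₀ + s • a) a) = 0 := by
  have hline : ∀ s : ℝ, HasDerivAt (fun s : ℝ => c₀ + s • a) a s := fun s => by
    have h := ((hasDerivAt_id s).smul_const a).const_add c₀
    rwa [one_smul] at h
  have hcont : Tendsto (fun s : ℝ => c₀ + s • a) (𝓝 0) (𝓝 c₀) := by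
    have h := (hline 0).continuousAt.tendsto
    rwa [zero_smul, add_zero] at h
  have hu : ∀ᶠ s in 𝓝 (0 : ℝ), HasDerivAt (fun s : ℝ => U (c₀ + s • a)) (dU (c₀ + s • a) a) s := hasDerivAt_ax_line hU a
  have hw : ∀ᶠ s in 𝓝 (0 : ℝ), HasDerivAt (fun s : ℝ => ω (c₀ + s • a)) (dω (c₀ + s • a) a) s := hasDerivAt_ax_line hω a
  have hUc : ContinuousAt U c₀ := hU.self_of_nhds.continuousAt
  have hf' : ∀ᶠ s in 𝓝 (0 : ℝ), HasFDerivAt f (mulVecCLM (Matrix.of (Hf (U (c₀ + s • a))))) (U (c₀ + s • a)) :=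
    hcont.eventually (hUc.eventually hf)
  have hJ' : ∀ᶠ s in 𝓝 (0 : ℝ), HasFDerivAt Jf (dJf (U (c₀ + s • a))) (U (c₀ + s • a)) := hcont.eventually (hUc.eventually hJ)
  have hid' : ∀ᶠ s in 𝓝 (0 : ℝ), ∀ᶠ s' in 𝓝 s, f (U (c₀ + s' • a)) + (Matrix.of (Jf (U (c₀ + s' • a))))ᵀ *ᵥ ω (c₀ + s' • a) = 0 :=
    (hcont.eventually hid).eventually_nhds
  filter_upwards [hu, hw, hf', hJ', hid'] with s hu hw hfs hJs hids
  have hfc : HasDerivAt (fun s : ℝ => f (U (c₀ + s • a))) (Matrix.of (Hf (U (c₀ + s • a))) *ᵥ dU (c₀ + s • a) a) s := by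
    have h := hfs.comp_hasDerivAt s hu
    rwa [mulVecCLM_apply] at h
  have hJc : HasDerivAt (fun s : ℝ => Jf (U (c₀ + s • a))) (dJf (U (c₀ + s • a)) (dU (c₀ + s • a) a)) s := hJs.comp_hasDerivAt s hu
  have h1 := hfc.add (hasDerivAt_of_transpose_mulVec hJc hw)
  have h2 : HasDerivAt (fun s : ℝ => f (U (c₀ + s • a)) + (Matrix.of (Jf (U (c₀ + s • a))))ᵀ *ᵥ ω (c₀ + s • a)) (0 : κ → ℝ) s :=
    (hasDerivAt_const s (0 : κ → ℝ)).congr_of_eventuallyEq hids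
  exact h1.unique h2

/-- [folklore] **FIRST ORDER AT A TADPOLE-FREE BASE POINT** (nonlinear twin of an2's K-U5 `fderiv_eq_of_identities`): if moreover `ω c₀ = 0` (on the
road: the base background is a critical point of the action, so the multiplier vanishes there — DISPLAYED) then
`H_c·dU c₀ a + J_cᵀ·dω c₀ a = 0` and `J_c·dU c₀ a = a`; hence, when `kkt H_c J_c` is nonsingular, `dU c₀ a = minOp H_c J_c a` («`U̇ = H a`») and
`dω c₀ a = −effForm H_c J_c a` («`−ω̇ = Δ a`»). -/
theorem dU_dω_eq_of_identities {f : (κ → ℝ) → (κ → ℝ)} {Hf : (κ → ℝ) → κ → κ → ℝ} {Q : (κ → ℝ) → (μ → ℝ)}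
    {Jf : (κ → ℝ) → μ → κ → ℝ} {dJf : (κ → ℝ) → ((κ → ℝ) →L[ℝ] (μ → κ → ℝ))} {U : (μ → ℝ) → (κ → ℝ)}
    {dU : (μ → ℝ) → ((μ → ℝ) →L[ℝ] (κ → ℝ))} {ω : (μ → ℝ) → (μ → ℝ)} {dω : (μ → ℝ) → ((μ → ℝ) →L[ℝ] (μ → ℝ))} {c₀ : μ → ℝ}
    (hf : ∀ᶠ x in 𝓝 (U c₀), HasFDerivAt f (mulVecCLM (Matrix.of (Hf x))) x)
    (hQ : ∀ᶠ x in 𝓝 (U c₀), HasFDerivAt Q (mulVecCLM (Matrix.of (Jf x))) x) (hJ : ∀ᶠ x in 𝓝 (U c₀), HasFDerivAt Jf (dJf x) x)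
    (hU : ∀ᶠ c in 𝓝 c₀, HasFDerivAt U (dU c) c) (hω : ∀ᶠ c in 𝓝 c₀, HasFDerivAt ω (dω c) c)
    (hid : ∀ᶠ c in 𝓝 c₀, f (U c) + (Matrix.of (Jf (U c)))ᵀ *ᵥ ω c = 0 ∧ Q (U c) = c) (hω0 : ω c₀ = 0)
    (hkkt : IsUnit (kkt (Matrix.of (Hf (U c₀))) (Matrix.of (Jf (U c₀)))).det) (a : μ → ℝ) :
    dU c₀ a = minOp (Matrix.of (Hf (U c₀))) (Matrix.of (Jf (U c₀))) *ᵥ a ∧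
      dω c₀ a = -(effForm (Matrix.of (Hf (U c₀))) (Matrix.of (Jf (U c₀))) *ᵥ a) := by
  set Hc := Matrix.of (Hf (U c₀)) with hHc
  set Jc := Matrix.of (Jf (U c₀)) with hJc
  have e0 : c₀ + (0 : ℝ) • a = c₀ := by rw [zero_smul, add_zero]
  -- the two first-order identities at the base point
  have p2 : Jc *ᵥ dU c₀ a = a := by
    have h := (jac_mulVec_dU_line hQ hU (hid.mono fun c h => h.2) a).self_of_nhds
    rwa [e0] at h
  have p1 : Hc *ᵥ dU c₀ a + Jcᵀ *ᵥ dω c₀ a = 0 := by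
    have h := (stationarity_deriv_line hf hJ hU hω (hid.mono fun c h => h.1) a).self_of_nhds
    rwa [e0, hω0, Matrix.mulVec_zero, zero_add] at h
  obtain ⟨h11, h12, h21, h22⟩ := blocks_mul_kkt Hc Jc hkkt
  constructor
  · have hneg : Hc *ᵥ dU c₀ a = -(Jcᵀ *ᵥ dω c₀ a) := eq_neg_of_add_eq_zero_left p1
    calc dU c₀ a = (flucCov Hc Jc * Hc + minOp Hc Jc * Jc) *ᵥ dU c₀ a := by rw [h11, Matrix.one_mulVec]
      _ = flucCov Hc Jc *ᵥ (Hc *ᵥ dU c₀ a) + minOp Hc Jc *ᵥ (Jc *ᵥ dU c₀ a) := by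
          rw [Matrix.add_mulVec, ← Matrix.mulVec_mulVec, ← Matrix.mulVec_mulVec]
      _ = minOp Hc Jc *ᵥ a := by
          rw [hneg, p2, Matrix.mulVec_neg, Matrix.mulVec_mulVec, h12, Matrix.zero_mulVec, neg_zero, zero_add]
  · have hneg : Jcᵀ *ᵥ dω c₀ a = -(Hc *ᵥ dU c₀ a) := eq_neg_of_add_eq_zero_right p1
    calc dω c₀ a = (minOpL Hc Jc * Jcᵀ) *ᵥ dω c₀ a := by rw [h22, Matrix.one_mulVec]
      _ = minOpL Hc Jc *ᵥ (Jcᵀ *ᵥ dω c₀ a) := by rw [← Matrix.mulVec_mulVec]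
      _ = -(effForm Hc Jc *ᵥ a) := by
          rw [hneg, Matrix.mulVec_neg, Matrix.mulVec_mulVec, h21, ← Matrix.mulVec_mulVec, p2]

/-! ## §2 The stationarity differentiated twice: the third jet along a line -/

omit [DecidableEq κ] [DecidableEq μ] in
/-- [folklore] **THE THIRD-ORDER IDENTITY (raw form, no non-degeneracy needed).**  Data as in §1, plus: the Hessian field's derivative `dH` at
`U c₀` (`A‴[v,w,z] = ((Matrix.of (dH v)) *ᵥ w) ⬝ᵥ z`), the constraint's second Jacobian derivative `d2Jf` at `U c₀` (`Q` thrice differentiable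
there), the second jets `d2U`, `d2ω` of the branch at `c₀`, the Hessian `Hf (U c₀)` symmetric, and the TADPOLE-FREE base point `ω c₀ = 0`.  Then, with
`w := dU c₀ a` («`H a`») and `w₁ := dω c₀ a` («`−Δ a`»):
`(d2ω a a) ⬝ a = −A‴[w,w,w] − 3·(w₁ ⬝ ∂²Q[w,w])`. -/
theorem d2ω_dotProduct {f : (κ → ℝ) → (κ → ℝ)} {Hf : (κ → ℝ) → κ → κ → ℝ} {dH : (κ → ℝ) →L[ℝ] (κ → κ → ℝ)}
    {Q : (κ → ℝ) → (μ → ℝ)} {Jf : (κ → ℝ) → μ → κ → ℝ} {dJf : (κ → ℝ) → ((κ → ℝ) →L[ℝ] (μ → κ → ℝ))}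
    {d2Jf : (κ → ℝ) →L[ℝ] (κ → ℝ) →L[ℝ] (μ → κ → ℝ)}
    {U : (μ → ℝ) → (κ → ℝ)} {dU : (μ → ℝ) → ((μ → ℝ) →L[ℝ] (κ → ℝ))} {d2U : (μ → ℝ) →L[ℝ] (μ → ℝ) →L[ℝ] (κ → ℝ)}
    {ω : (μ → ℝ) → (μ → ℝ)} {dω : (μ → ℝ) → ((μ → ℝ) →L[ℝ] (μ → ℝ))} {d2ω : (μ → ℝ) →L[ℝ] (μ → ℝ) →L[ℝ] (μ → ℝ)} {c₀ : μ → ℝ}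
    (hf : ∀ᶠ x in 𝓝 (U c₀), HasFDerivAt f (mulVecCLM (Matrix.of (Hf x))) x) (hH : HasFDerivAt Hf dH (U c₀))
    (hsym : (Matrix.of (Hf (U c₀)))ᵀ = Matrix.of (Hf (U c₀)))
    (hQ : ∀ᶠ x in 𝓝 (U c₀), HasFDerivAt Q (mulVecCLM (Matrix.of (Jf x))) x) (hJ : ∀ᶠ x in 𝓝 (U c₀), HasFDerivAt Jf (dJf x) x)
    (hdJ : HasFDerivAt dJf d2Jf (U c₀))
    (hU : ∀ᶠ c in 𝓝 c₀, HasFDerivAt U (dU c) c) (hdU : HasFDerivAt dU d2U c₀)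
    (hω : ∀ᶠ c in 𝓝 c₀, HasFDerivAt ω (dω c) c) (hdω : HasFDerivAt dω d2ω c₀)
    (hid : ∀ᶠ c in 𝓝 c₀, f (U c) + (Matrix.of (Jf (U c)))ᵀ *ᵥ ω c = 0 ∧ Q (U c) = c) (hω0 : ω c₀ = 0) (a : μ → ℝ) :
    d2ω a a ⬝ᵥ a = -((Matrix.of (dH (dU c₀ a)) *ᵥ dU c₀ a) ⬝ᵥ dU c₀ a)
      - 3 * (dω c₀ a ⬝ᵥ (Matrix.of (dJf (U c₀) (dU c₀ a)) *ᵥ dU c₀ a)) := by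
  have e0 : c₀ + (0 : ℝ) • a = c₀ := by rw [zero_smul, add_zero]
  -- jets of the branch along the line
  have hu : ∀ᶠ s in 𝓝 (0 : ℝ), HasDerivAt (fun s : ℝ => U (c₀ + s • a)) (dU (c₀ + s • a) a) s := hasDerivAt_ax_line hU a
  have hu₁ : HasDerivAt (fun s : ℝ => dU (c₀ + s • a) a) (d2U a a) 0 := hasDerivAt_dax_line hdU a
  have hw : ∀ᶠ s in 𝓝 (0 : ℝ), HasDerivAt (fun s : ℝ => ω (c₀ + s • a)) (dω (c₀ + s • a) a) s := hasDerivAt_ax_line hω a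
  have hw₁ : HasDerivAt (fun s : ℝ => dω (c₀ + s • a) a) (d2ω a a) 0 := hasDerivAt_dax_line hdω a
  have hu0 : HasDerivAt (fun s : ℝ => U (c₀ + s • a)) (dU (c₀ + (0 : ℝ) • a) a) 0 := hu.self_of_nhds
  have hw0 : HasDerivAt (fun s : ℝ => ω (c₀ + s • a)) (dω (c₀ + (0 : ℝ) • a) a) 0 := hw.self_of_nhds
  -- the matrix fields along the line, at 0
  have hH' : HasFDerivAt Hf dH ((fun s : ℝ => U (c₀ + s • a)) 0) := by
    show HasFDerivAt Hf dH (U (c₀ + (0 : ℝ) • a)); rw [e0]; exact hH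
  have hHc : HasDerivAt (fun s : ℝ => Hf (U (c₀ + s • a))) (dH (dU (c₀ + (0 : ℝ) • a) a)) 0 := hH'.comp_hasDerivAt (0 : ℝ) hu0
  have hJ0 : HasFDerivAt Jf (dJf (U c₀)) ((fun s : ℝ => U (c₀ + s • a)) 0) := by
    show HasFDerivAt Jf (dJf (U c₀)) (U (c₀ + (0 : ℝ) • a)); rw [e0]; exact hJ.self_of_nhds
  have hJc : HasDerivAt (fun s : ℝ => Jf (U (c₀ + s • a))) (dJf (U c₀) (dU (c₀ + (0 : ℝ) • a) a)) 0 :=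
    hJ0.comp_hasDerivAt (0 : ℝ) hu0
  have hdJ' : HasFDerivAt dJf d2Jf ((fun s : ℝ => U (c₀ + s • a)) 0) := by
    show HasFDerivAt dJf d2Jf (U (c₀ + (0 : ℝ) • a)); rw [e0]; exact hdJ
  have hX : HasDerivAt (fun s : ℝ => dJf (U (c₀ + s • a)) (dU (c₀ + s • a) a))
      (d2Jf (dU (c₀ + (0 : ℝ) • a) a) (dU (c₀ + (0 : ℝ) • a) a) + dJf (U (c₀ + (0 : ℝ) • a)) (d2U a a)) 0 :=
    hasDerivAt_jet₁_comp_curve (γ := fun s : ℝ => U (c₀ + s • a)) (γ₁ := fun s : ℝ => dU (c₀ + s • a) a) hu0 hu₁ hdJ'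
  -- the derivative at 0 of the once-differentiated stationarity
  have hT := (hasDerivAt_of_mulVec hHc hu₁).add ((hasDerivAt_of_transpose_mulVec hX hw0).add (hasDerivAt_of_transpose_mulVec hJc hw₁))
  have hS1 := stationarity_deriv_line hf hJ hU hω (hid.mono fun c h => h.1) a
  have hT0 : HasDerivAt (fun s : ℝ => Matrix.of (Hf (U (c₀ + s • a))) *ᵥ dU (c₀ + s • a) a
      + ((Matrix.of (dJf (U (c₀ + s • a)) (dU (c₀ + s • a) a)))ᵀ *ᵥ ω (c₀ + s • a)
        + (Matrix.of (Jf (U (c₀ + s • a))))ᵀ *ᵥ dω (c₀ + s • a) a)) (0 : κ → ℝ) 0 :=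
    (hasDerivAt_const (0 : ℝ) (0 : κ → ℝ)).congr_of_eventuallyEq hS1
  have hS2 := hT.unique hT0
  simp only [e0, hω0, Matrix.mulVec_zero, zero_add] at hS2
  -- the first- and second-order identities at the base point
  have p2 : Matrix.of (Jf (U c₀)) *ᵥ dU c₀ a = a := by
    have h := (jac_mulVec_dU_line hQ hU (hid.mono fun c h => h.2) a).self_of_nhds
    rwa [e0] at h
  have p1 : Matrix.of (Hf (U c₀)) *ᵥ dU c₀ a + (Matrix.of (Jf (U c₀)))ᵀ *ᵥ dω c₀ a = 0 := by
    have h := hS1.self_of_nhds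
    rwa [e0, hω0, Matrix.mulVec_zero, zero_add] at h
  have pE2 := jac_mulVec_d2U hQ hJ.self_of_nhds hU hdU (hid.mono fun c h => h.2) a
  -- scalar bookkeeping: pair (S2) with `w := dU c₀ a`
  set w := dU c₀ a with hw_def
  set w₁ := dω c₀ a with hw₁_def
  set Hc := Matrix.of (Hf (U c₀)) with hHc_def
  set Jc := Matrix.of (Jf (U c₀)) with hJc_def
  set q := Matrix.of (dJf (U c₀) w) *ᵥ w with hq_def
  have A1 : w ⬝ᵥ (Hc *ᵥ d2U a a) = w₁ ⬝ᵥ q := by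
    have h1 : w ⬝ᵥ (Hc *ᵥ d2U a a) = (Hc *ᵥ w) ⬝ᵥ d2U a a := by
      rw [← transpose_mulVec_dotProduct, hsym]
    have h2 : Hc *ᵥ w = -(Jcᵀ *ᵥ w₁) := eq_neg_of_add_eq_zero_left p1
    have h3 : Jc *ᵥ d2U a a = -q := eq_neg_of_add_eq_zero_right pE2
    rw [h1, h2, neg_dotProduct, transpose_mulVec_dotProduct, h3, dotProduct_neg, neg_neg]
  have A2 : w ⬝ᵥ ((Matrix.of (dJf (U c₀) w))ᵀ *ᵥ w₁) = w₁ ⬝ᵥ q := by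
    rw [dotProduct_comm, transpose_mulVec_dotProduct]
  have A3 : w ⬝ᵥ (Jcᵀ *ᵥ d2ω a a) = d2ω a a ⬝ᵥ a := by
    rw [dotProduct_comm, transpose_mulVec_dotProduct, p2]
  have A0 : w ⬝ᵥ (Matrix.of (dH w) *ᵥ w) = (Matrix.of (dH w) *ᵥ w) ⬝ᵥ w := dotProduct_comm _ _
  have main := congrArg (fun z : κ → ℝ => w ⬝ᵥ z) hS2
  simp only [dotProduct_add, dotProduct_zero] at main
  rw [A0, A1, A2, A3] at main
  linarith

end Branch

end Summit.QuantumFields.BalabanUV.Beta.FP.ValueFunctionThirdJet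

end
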